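import Mathlib.Geometry.Manifold.LocalDiffeomorph
import Mathlib.Geometry.Manifold.MFDeriv.Basic
import Mathlib.Geometry.Manifold.Instances.Real
import Mathlib.Topology.Covering.Basic
import HarnessLib

/-!
# Finite cube complexes on a space, Gromov's link condition, and the cubical Cartan–Hadamard
package in dimension four

Topic `Literature/Geometry/MetricGeometry`; DEFINITIONS (with bodies) and ONE named fact (result in
print, `def … : Prop`, D-0014), requested as definition item `defn-IsLocallyCATZeroCubulation`
(D1 of route `Summit.SmoothPoincare4.SmoothPoincare4.Theses.CartanHadamardSwindle`, needed to type
the informal crux `CubicalFarrellJonesFour`, `stmt-SmoothPoincare4-8138`).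

## Contents

* `stdCube d`, `CubeFace d` (`= Fin d → Option Bool`, `none` = free coordinate), `CubeFace.carrier`,
  `cornerPt`, `cornerEdge`, `flipCoords`, `faceChart` — the standard cube `[0,1]^d ⊆ ℝ^d`, its
  faces, vertices, the edges at a vertex, and the affine isometric parametrisation of a face by a
  lower-dimensional standard cube composed with a symmetry of that cube (coordinate permutation
  `σ` and reflections `ρ`).
* `Cubulation M` — a **finite (regular) cube complex structure** on a topological space `M`
  (Bridson–Haefliger 1999, Ch. I.7, "cubed complexes", with injective characteristic maps and
  single-face intersections; Davis' "cubical cell complexes"): finitely many closed cells given by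
  characteristic maps `χ_i : [0,1]^{d_i} → M` which are continuous and INJECTIVE on the closed
  cube (cells embedded), cover `M`, are pairwise distinct, every face of a cell is a cell
  (re-parametrised isometrically, `face`), and two cells meet in a single common face or not at
  all (`inter`).
* `Cubulation.linkVertices / linkSimplices / IsFlagAt / IsLocallyCATZero` — the **vertex link**
  as an abstract finite simplicial complex (vertices = edges of the complex at `v`, simplices =
  the sets of edges at `v` of the corners of cells at `v`; in a regular complex this IS a
  simplicial complex, module docstring below) and **Gromov's link condition**: every vertex link
  is a FLAG complex (every finite set of pairwise adjacent vertices spans a simplex) — by Gromov's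
  theorem (Gromov 1987, §4.2.C; Bridson–Haefliger 1999, II.5.20) this is equivalent to the
  piecewise-Euclidean unit-cube metric being locally CAT(0) (non-positively curved).
* `Cubulation.IsSmooth n` — compatibility with a smooth structure on `M` modelled on `ℝⁿ`: every
  characteristic map extends to a smooth EMBEDDING of an open neighbourhood of the closed cube
  (smooth, injective, injective differential); after the symmetric simplicial subdivision of the
  cubes this is a smooth (Whitehead) triangulation, so the cubes are PL cells of the PL structure
  underlying the smooth one and the cubical metric is a PL-compatible polyhedral metric.
* `IsLocallyCATZeroCubulation n C := C.IsLocallyCATZero ∧ C.IsSmooth n` (the requested notion) and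
  `AdmitsLocallyCATZeroCubulation n M := ∃ C, IsLocallyCATZeroCubulation n C`.
* `Stone1976_cubical_cartanHadamard_four` — the NAMED FACT, the "single packaged fact" of the
  request (F1 + F2 + F3): a compact connected smooth `4`-manifold admitting a smoothly compatible
  locally CAT(0) cubulation is smoothly covered by standard `ℝ⁴`.

## The packaged fact and its sources

For `M` compact, connected, smooth of dimension `4` with a `Cubulation` `C` satisfying
`IsLocallyCATZeroCubulation 4 C`:
(F2) the length metric in which every cell is a unit Euclidean cube is locally CAT(0) by Gromov's
link condition (Bridson–Haefliger II.5.20), so by the Cartan–Hadamard theorem for complete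
locally CAT(0) spaces (Bridson–Haefliger II.4.1(2); Gromov 1987) the universal cover `M̃` with the
lifted cubical structure is a CAT(0) cube complex; (F1) `M̃` is a simply connected PL `4`-manifold
(PL structure from the smooth triangulation refining the lifted cubulation) whose CAT(0) metric is
a PL-compatible piecewise-Euclidean polyhedral metric, hence by STONE's PL Cartan–Hadamard theorem
(Stone 1976: a complete simply connected PL manifold of non-positive curvature — equivalently,
whose PL-compatible polyhedral metric is CAT(0) — is PL-homeomorphic to `ℝⁿ`) `M̃ ≅_{PL} ℝ⁴`;
(F3) in dimension `≤ 6` a PL manifold carries a unique compatible smooth structure up to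
diffeomorphism (Hirsch–Mazur 1974; `PL/O` is `6`-connected), so `M̃` with its lifted smooth
structure is DIFFEOMORPHIC to standard `ℝ⁴`, and composing with the covering projection gives a
smooth covering map `ℝ⁴ → M` which is a local diffeomorphism. Rendered exactly in the shape the
route's assembly consumes (`IsCoveringMap`, `Function.Surjective`, `IsLocalDiffeomorph (𝓡 4) (𝓡 4) ∞`).
The PL-compatibility hypothesis (here: `IsSmooth`) cannot be dropped: Davis–Januszkiewicz (1991)
hyperbolised non-PL triangulations give closed manifolds with locally CAT(0) polyhedral metrics
whose universal covers are not simply connected at infinity (dimension `≥ 5`).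

## Design and faithfulness notes

* REGULARITY (`injOn`, `distinct`, `inter`) is Bridson–Haefliger's standing convention for
  cubical complexes built from injective characteristic maps with intersections single faces; it
  is what makes the vertex link a simplicial complex: two distinct cells at `v` cannot have the
  same set of edges at `v` (their intersection would be a common face containing all edges at a
  corner, i.e. the whole cell). General "cubed complexes" with self-gluings (whose links may fail
  to be simplicial) are NOT covered; every such complex becomes regular after cubical subdivision,
  which does not change the metric, so no locally CAT(0) cubulated manifold is lost up to
  subdivision.
* Links are encoded extrinsically: a vertex of `Lk(v)` is an edge of the complex at `v` as a
  SUBSET of `M`, a simplex is a set of such edges; no quotient types.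
* `face` allows the re-parametrisation of a face by any symmetry of the lower cube (`σ`, `ρ`), as
  printed ("glued by isometries of faces").
* `IsSmooth` asks for a smooth embedding of an open neighbourhood of each CLOSED cube (the usual
  meaning of "smoothly embedded closed cell"), with source model `𝓘(ℝ, Fin d → ℝ)` and target
  model `𝓡 n`.
* The topology of `M` is that of the given space; for compact Hausdorff `M` (the only use) it is
  the weak topology of the finite complex.

## What is NOT here

CAT(0) metric spaces, the piecewise-Euclidean length metric of a cube complex, Gromov's theorem
II.5.20 and the Cartan–Hadamard theorem II.4.1 as separate statements, PL manifolds and Stone's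
theorem in PL form, smoothing theory (F3) as a separate statement — none has a carrier in the tree
or Mathlib; the three printed theorems enter only through the packaged fact, as the request allows.
-/

noncomputable section

open Set Function
open scoped Manifold ContDiff

namespace Literature.Geometry.MetricGeometry

/-! ### The standard cube, its faces, corners and edges -/

/-- The standard closed cube `[0,1]^d ⊆ ℝ^d`. [folklore] -/
def stdCube (d : ℕ) : Set (Fin d → ℝ) :=
  {x | ∀ k, x k ∈ Icc (0 : ℝ) 1}

/-- A **face** of the standard `d`-cube: for each coordinate either a fixed value `0`/`1`
(`some false` / `some true`) or "free" (`none`). [cite: BridsonHaefliger1999, Ch. I.7 (cubed complexes)] -/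
abbrev CubeFace (d : ℕ) : Type := Fin d → Option Bool

/-- The real number `0` or `1` encoded by a Boolean. [folklore] -/
def boolPt (b : Bool) : ℝ := if b then 1 else 0

/-- The closed subset of the standard cube underlying a face. [cite: BridsonHaefliger1999, Ch. I.7 (cubed complexes)] -/
def CubeFace.carrier {d : ℕ} (f : CubeFace d) : Set (Fin d → ℝ) :=
  {x ∈ stdCube d | ∀ k b, f k = some b → x k = boolPt b}

/-- The corner (vertex) of the standard cube with Boolean coordinates `c`. [folklore] -/
def cornerPt {d : ℕ} (c : Fin d → Bool) : Fin d → ℝ := fun k ↦ boolPt (c k)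

/-- The closed edge of the standard cube at the corner `c` in the coordinate direction `k`. [folklore] -/
def cornerEdge {d : ℕ} (c : Fin d → Bool) (k : Fin d) : Set (Fin d → ℝ) :=
  {x ∈ stdCube d | ∀ l, l ≠ k → x l = cornerPt c l}

/-- A product of reflections `y_k ↦ 1 − y_k` (for `ρ k = true`) of the standard cube. [folklore] -/
def flipCoords {m : ℕ} (ρ : Fin m → Bool) (y : Fin m → ℝ) : Fin m → ℝ :=
  fun k ↦ if ρ k then 1 - y k else y k

/-- The affine isometric parametrisation of the face `f` of the `d`-cube by the `m`-cube along an
enumeration `σ` of the free coordinates of `f`: free coordinates are filled with `y ∘ σ⁻¹`, fixed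
ones with their values. [cite: BridsonHaefliger1999, Ch. I.7 (cubed complexes)] -/
def faceChart {d m : ℕ} (f : CubeFace d) (σ : Fin m ≃ {k : Fin d // f k = none})
    (y : Fin m → ℝ) : Fin d → ℝ :=
  fun k ↦ if h : f k = none then y (σ.symm ⟨k, h⟩) else
    if f k = some true then 1 else 0

/-! ### Finite regular cube complexes on a space -/

/-- A **finite (regular) cube complex structure** on the topological space `M` — a "cubulation"
of `M` (Bridson–Haefliger 1999, Ch. I.7, cubed complexes, here with injective characteristic maps
and single-face intersections; Davis, *The geometry and topology of Coxeter groups*, App. A,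
"cubical cell complexes"): finitely many cells
`i : ι` of dimensions `dim i` with characteristic maps `map i : ℝ^{dim i} → M` which on the
closed standard cube are continuous and injective (embedded closed cells), whose images cover
`M` and are pairwise distinct, such that every face of a cell, re-parametrised isometrically by a
standard cube (up to a symmetry of that cube), is again a cell (`face`), and any two cells meet
in a single common face of each, or not at all (`inter`). [cite: BridsonHaefliger1999, Ch. I.7 (cubed complexes)] -/
structure Cubulation (M : Type*) [TopologicalSpace M] where
  /-- The index type of cells. -/
  ι : Type
  /-- Finitely many cells. -/
  finite_ι : Finite ι
  /-- The dimension of each cell. -/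
  dim : ι → ℕ
  /-- The characteristic map of each cell, defined on all of `ℝ^{dim i}` (only its values on the
  closed standard cube matter, except in `Cubulation.IsSmooth`). -/
  map : (i : ι) → (Fin (dim i) → ℝ) → M
  /-- Characteristic maps are continuous on the closed cube. -/
  continuousOn : ∀ i, ContinuousOn (map i) (stdCube (dim i))
  /-- Characteristic maps are injective on the closed cube (cells are embedded). -/
  injOn : ∀ i, InjOn (map i) (stdCube (dim i))
  /-- The cells cover `M`. -/
  cover : (⋃ i, map i '' stdCube (dim i)) = univ
  /-- Distinct indices give distinct cells. -/
  distinct : ∀ i j, map i '' stdCube (dim i) = map j '' stdCube (dim j) → i = j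
  /-- Every face of a cell is a cell: the face `f` of cell `i`, parametrised by `faceChart f σ`
  composed with reflections `flipCoords ρ`, is the characteristic map of some cell `j`. -/
  face : ∀ (i : ι) (f : CubeFace (dim i)),
    ∃ (j : ι) (σ : Fin (dim j) ≃ {k : Fin (dim i) // f k = none}) (ρ : Fin (dim j) → Bool),
      ∀ y ∈ stdCube (dim j), map j y = map i (faceChart f σ (flipCoords ρ y))
  /-- Two cells are disjoint or meet in (the image of) a single face of the first. -/
  inter : ∀ i j, map i '' stdCube (dim i) ∩ map j '' stdCube (dim j) = ∅ ∨
    ∃ f : CubeFace (dim i), map i '' stdCube (dim i) ∩ map j '' stdCube (dim j) = map i '' f.carrier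

namespace Cubulation

variable {M : Type*} [TopologicalSpace M] (C : Cubulation M)

/-- The closed cell of index `i`. [cite: BridsonHaefliger1999, Ch. I.7 (cubed complexes)] -/
def cell (i : C.ι) : Set M := C.map i '' stdCube (C.dim i)

/-- `v` is a **vertex** of the complex: the image of a corner of a cell. [cite: BridsonHaefliger1999, Ch. I.7 (cubed complexes)] -/
def IsVertex (v : M) : Prop := ∃ (i : C.ι) (c : Fin (C.dim i) → Bool), C.map i (cornerPt c) = v

/-- The edge of the complex through the corner `c` of the cell `i` in direction `k` (a closed
`1`-cell, as a subset of `M`). [cite: BridsonHaefliger1999, Ch. I.7 (cubed complexes)] -/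
def edgeAt (i : C.ι) (c : Fin (C.dim i) → Bool) (k : Fin (C.dim i)) : Set M :=
  C.map i '' cornerEdge c k

/-- **Vertices of the link** `Lk(v)`: the edges of the complex at `v` (Bridson–Haefliger Ch. I.7, the
geometric link, and Ch. II.5, 5.18–5.20: its vertices correspond to the edges issuing from `v`).
[cite: BridsonHaefliger1999, Ch. I.7 (geometric links) and Ch. II.5 (5.18–5.20)] -/
def linkVertices (v : M) : Set (Set M) :=
  {E | ∃ (i : C.ι) (c : Fin (C.dim i) → Bool) (k : Fin (C.dim i)),
    C.map i (cornerPt c) = v ∧ E = C.edgeAt i c k}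

/-- **Simplices of the link** `Lk(v)`: for each cell `i` with a corner `c` at `v`, the set of the
`dim i` edges of `i` at that corner (an abstract `(dim i − 1)`-simplex on `linkVertices v`); faces
of cells being cells, this family is closed under passing to subsets realised by faces.
[cite: BridsonHaefliger1999, Ch. I.7 (geometric links) and Ch. II.5 (5.18–5.20)] -/
def linkSimplices (v : M) : Set (Set (Set M)) :=
  {s | ∃ (i : C.ι) (c : Fin (C.dim i) → Bool), C.map i (cornerPt c) = v ∧ s = range (C.edgeAt i c)}

/-- **The link at `v` is a flag complex** (Gromov's "no empty simplices" condition): every set of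
vertices of `Lk(v)` which are pairwise joined by edges of `Lk(v)` (i.e. pairwise contained in a
common simplex) is contained in a simplex. [cite: BridsonHaefliger1999, Ch. II.5 (flag complexes, Def. 5.15; Thm. 5.20)] -/
def IsFlagAt (v : M) : Prop :=
  ∀ S ⊆ C.linkVertices v,
    (∀ E ∈ S, ∀ E' ∈ S, ∃ s ∈ C.linkSimplices v, E ∈ s ∧ E' ∈ s) →
      ∃ s ∈ C.linkSimplices v, S ⊆ s

/-- **Gromov's link condition** — the cube complex is *locally CAT(0)* (non-positively curved):
the link of every vertex is a flag complex. By Gromov's theorem (Gromov 1987, §4.2.C;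
Bridson–Haefliger 1999, Thm. II.5.20) this is equivalent to the piecewise-Euclidean metric with
unit cubes being locally CAT(0); the combinatorial condition is taken as the definition.
[cite: Gromov1987, §4.2.C] -/
def IsLocallyCATZero (C : Cubulation M) : Prop :=
  ∀ v, C.IsVertex v → C.IsFlagAt v

/-- **Compatibility with a smooth structure** on `M` (modelled on `ℝⁿ`): every characteristic map
is a smooth EMBEDDING of an open neighbourhood `U ⊇ [0,1]^{dim i}` of the closed cube — smooth
(`ContMDiffOn`, source model `𝓘(ℝ, Fin d → ℝ)`, target `𝓡 n`), injective, with injective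
differential at every point of `U`. Such a cubulation refines (by the symmetric simplicial
subdivision of cubes) to a smooth triangulation, so its cells are PL cells of the Whitehead PL
structure of `M` and its cubical metric is a PL-compatible polyhedral metric.
[cite: HirschMazur1974, (smooth triangulations and PL structures)] -/
def IsSmooth (n : ℕ) [ChartedSpace (EuclideanSpace ℝ (Fin n)) M] [IsManifold (𝓡 n) ∞ M] : Prop :=
  ∀ i : C.ι, ∃ U : Set (Fin (C.dim i) → ℝ), IsOpen U ∧ stdCube (C.dim i) ⊆ U ∧
    ContMDiffOn 𝓘(ℝ, Fin (C.dim i) → ℝ) (𝓡 n) ∞ (C.map i) U ∧ InjOn (C.map i) U ∧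
      ∀ x ∈ U, Injective (mfderiv 𝓘(ℝ, Fin (C.dim i) → ℝ) (𝓡 n) (C.map i) x)

end Cubulation

/-- **A locally CAT(0) cubulation compatible with the smooth structure** (the requested notion
`IsLocallyCATZeroCubulation`): all vertex links of `C` are flag complexes (Gromov's link
condition) and every closed cell is smoothly embedded. [cite: Gromov1987, §4.2.C] -/
def IsLocallyCATZeroCubulation {M : Type*} [TopologicalSpace M] (n : ℕ)
    [ChartedSpace (EuclideanSpace ℝ (Fin n)) M] [IsManifold (𝓡 n) ∞ M] (C : Cubulation M) : Prop :=
  C.IsLocallyCATZero ∧ C.IsSmooth n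

/-- `M` **admits a locally CAT(0) cubulation** compatible with its smooth structure.
[cite: Gromov1987, §4.2.C] -/
def AdmitsLocallyCATZeroCubulation (n : ℕ) (M : Type*) [TopologicalSpace M]
    [ChartedSpace (EuclideanSpace ℝ (Fin n)) M] [IsManifold (𝓡 n) ∞ M] : Prop :=
  ∃ C : Cubulation M, IsLocallyCATZeroCubulation n C

/-! ### The packaged fact -/

/-- **Cubical Cartan–Hadamard package in dimension four** (F1 Stone 1976, PL Cartan–Hadamard: a
complete simply connected PL manifold of non-positive curvature, i.e. carrying a CAT(0)
PL-compatible piecewise-Euclidean polyhedral metric, is PL-homeomorphic to `ℝⁿ`; F2 Gromov's link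
condition and the Cartan–Hadamard theorem for complete locally CAT(0) length spaces,
Bridson–Haefliger 1999, Thms. II.5.20 and II.4.1(2): the universal cover of a compact cube
complex with flag links is a CAT(0) cube complex; F3 Hirsch–Mazur 1974: a PL manifold of
dimension `≤ 6` has a unique compatible smoothing up to diffeomorphism, so `PL ≅ ℝ⁴` implies
`DIFF ≅ ℝ⁴`), NAMED FACT, packaged in the form the route's assembly consumes: a compact connected
Hausdorff second-countable smooth `4`-manifold which admits a locally CAT(0) cubulation
compatible with its smooth structure is the quotient of STANDARD `ℝ⁴` by a smooth covering
action — there is a surjective covering map `π : ℝ⁴ → M` which is a local diffeomorphism.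
[cite: Stone1976, Main Theorem] [cite: BridsonHaefliger1999, II.4.1(2) and II.5.20] [cite: HirschMazur1974, (uniqueness of smoothings, PL/O 6-connected)] -/
def Stone1976_cubical_cartanHadamard_four : Prop :=
  ∀ (M : Type) [TopologicalSpace M] [T2Space M] [SecondCountableTopology M]
    [ChartedSpace (EuclideanSpace ℝ (Fin 4)) M] [IsManifold (𝓡 4) ∞ M]
    [CompactSpace M] [ConnectedSpace M],
    AdmitsLocallyCATZeroCubulation 4 M →
      ∃ π : EuclideanSpace ℝ (Fin 4) → M,
        IsCoveringMap π ∧ Surjective π ∧ IsLocalDiffeomorph (𝓡 4) (𝓡 4) ∞ π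

/-! ### API -/

section API

variable {M : Type*} [TopologicalSpace M]

/-- The standard cube is the product of unit intervals (`Set.pi` form). [folklore] -/
theorem stdCube_eq_pi (d : ℕ) : stdCube d = Set.pi univ fun _ ↦ Icc (0 : ℝ) 1 := by
  ext x; simp only [stdCube, mem_setOf_eq, mem_pi, mem_univ, forall_const]

/-- The standard cube is compact. [folklore] -/
theorem isCompact_stdCube (d : ℕ) : IsCompact (stdCube d) := by
  rw [stdCube_eq_pi]; exact isCompact_univ_pi fun _ ↦ isCompact_Icc

/-- Corners lie in the cube. [folklore] -/
theorem cornerPt_mem_stdCube {d : ℕ} (c : Fin d → Bool) : cornerPt c ∈ stdCube d := by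
  intro k; unfold cornerPt boolPt; split_ifs <;> norm_num

/-- A corner lies on each of its edges. [folklore] -/
theorem cornerPt_mem_cornerEdge {d : ℕ} (c : Fin d → Bool) (k : Fin d) :
    cornerPt c ∈ cornerEdge c k :=
  ⟨cornerPt_mem_stdCube c, fun _ _ ↦ rfl⟩

/-- The carrier of the face with all coordinates free is the whole cube. [folklore] -/
theorem CubeFace.carrier_none (d : ℕ) : CubeFace.carrier (fun _ : Fin d ↦ (none : Option Bool)) = stdCube d := by
  ext x; simp [CubeFace.carrier]

/-- Cells are compact: continuous images of the compact cube. [folklore] -/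
theorem Cubulation.isCompact_cell (C : Cubulation M) (i : C.ι) : IsCompact (C.cell i) :=
  (isCompact_stdCube _).image_of_continuousOn (C.continuousOn i)

/-- Every point of `M` lies in some cell. [folklore] -/
theorem Cubulation.exists_mem_cell (C : Cubulation M) (x : M) : ∃ i, x ∈ C.cell i := by
  have hx : x ∈ ⋃ i, C.map i '' stdCube (C.dim i) := by rw [C.cover]; exact mem_univ x
  simpa [Cubulation.cell] using mem_iUnion.1 hx

/-- The vertices of a corner simplex of the link are link vertices. [folklore] -/
theorem Cubulation.range_edgeAt_subset_linkVertices (C : Cubulation M) {v : M} {i : C.ι}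
    {c : Fin (C.dim i) → Bool} (hv : C.map i (cornerPt c) = v) :
    range (C.edgeAt i c) ⊆ C.linkVertices v := by
  rintro E ⟨k, rfl⟩
  exact ⟨i, c, k, hv, rfl⟩

/-- A locally CAT(0) smooth cubulation witnesses `AdmitsLocallyCATZeroCubulation`. [folklore] -/
theorem admitsLocallyCATZeroCubulation_of {n : ℕ} [ChartedSpace (EuclideanSpace ℝ (Fin n)) M]
    [IsManifold (𝓡 n) ∞ M] (C : Cubulation M) (h₁ : C.IsLocallyCATZero) (h₂ : C.IsSmooth n) :
    AdmitsLocallyCATZeroCubulation n M :=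
  ⟨C, h₁, h₂⟩

end API

end Literature.Geometry.MetricGeometry
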